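import Literature.NumberTheory.EllipticCurves.DeepCongruenceFiniteness
import Literature.NumberTheory.EllipticCurves.EichlerShimuraConstruction
import Literature.NumberTheory.EllipticCurves.NewformsLevelEqOfHeckeEigenvalueEqProofs
import Literature.NumberTheory.EllipticCurves.PAdicLFunctionDistributionProofs
import Literature.NumberTheory.EllipticCurves.LFunctionPrimeCoeff
import Literature.NumberTheory.EllipticCurves.ModularityVersionApProofs
import Literature.NumberTheory.EllipticCurves.GaloisAction
import Literature.NumberTheory.EllipticCurves.GlobalMinimalModel
import HarnessLib

/-!
# BirchSwinnertonDyer / ShadowIsolation — crux `IsolationOfAccidentalZeros`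
# (stmt-BirchSwinnertonDyer-15786), line `registered`, stub **F_rat** `stub_rationalSectorFinite`

Registered stub **F_rat** ("rational sector finite at one depth") of the skeleton
`Cruxes/IsolationOfAccidentalZeros/Lines/birth.lean` (v3): GIVEN the Eichler–Shimura construction
(`eichlerShimuraConstruction`, first hypothesis) and the finiteness of deep congruences to a fixed
elliptic curve (`DeepCongruenceFinite`, second hypothesis; Mordell–Faltings on the twisted modular
curves `X_E^α(pⁿ)`, `pⁿ ≥ 7`, with Carayol's theorem — the named Literature fact
`Literature.NumberTheory.EllipticCurves.DeepCongruenceFinite` of `DeepCongruenceFiniteness.lean`), for `W/ℚ`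
globally minimal elliptic and `p ≥ 5` with `E[p]` irreducible there is a depth `n` (namely `n = 2`,
`p² ≥ 25 ≥ 7`) at which the pairs `(M, g)` — `M` squarefree and coprime to `p·N_W`,
`g ∈ S₂(Γ₀(N_W·M))` a newform with INTEGER `q`-expansion — which are depth-`n` congruent to `W`
(`φ(a_ℓ(g)) = a_ℓ(W)` in `ℤ/pⁿ` for the primes `ℓ ∤ N_W·M`, `φ : R → ℤ/pⁿ` a ring homomorphism on a
subring `R ⊆ ℂ` containing these `a_ℓ(g)`) form a FINITE set.

Proof (bookkeeping over proved tree theorems, modulo the two hypotheses).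
* The coefficient map `(M, g) ↦ (aₘ(g))ₘ` is injective on pairs with `g` a newform
  (`stubF_sigma_mk_eq_of_qExpansion_coeff_eq`): equal `q`-expansions give equal Hecke eigenvalues
  at every prime (`IsNewform0.heckeEigenvalue_eq_coeff_holds`), so `N_W·M = N_W·M'` by strong
  multiplicity one across levels (`IsNewform0.level_eq_of_heckeEigenvalue_eq_holds`), `M = M'`
  (`N_W > 0`, `WeierstrassCurve.conductorNorm_pos_holds`), and `g = g'` by the `q`-expansion
  principle (`eq_of_forall_cuspCoeff_eq_gamma0`).
* Its image lies in (the complexification of) the finite set of `DeepCongruenceFinite` at depth `2`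
  (`stubF_exists_curve_of_congruent`): the Eichler–Shimura curve `E_g` of `g` has
  `aₘ(g) = aₘ(E_g)` (`IsNewformOf`), and at a prime `ℓ ∤ N_W·M` the congruence
  `φ(a_ℓ(g)) = a_ℓ(W)` reads `p² ∣ a_ℓ(E_g) − a_ℓ(W)` in `ℤ` (`map_intCast`; `a_ℓ(W) = frobeniusTrace W ℓ`
  by `WeierstrassCurve.LFunction_apply_prime_eq_frobeniusTrace`, good reduction at `ℓ ∤ N_W` by
  `WeierstrassCurve.dvd_conductorNorm_iff_not_hasGoodReductionAtPrime`), so the exceptional primes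
  divide `N_W·M`.
The hypotheses "good ordinary at `p`" are not used by this stub; `5 ≤ p` gives `p ≠ 2` and
`7 ≤ p²`, consumed together with the irreducibility of `E[p]` by `DeepCongruenceFinite`.
-/

set_option linter.dupNamespace false

noncomputable section

namespace Summit.BirchSwinnertonDyer.BirchSwinnertonDyer.Theorems

open scoped MatrixGroups ModularForm
open CongruenceSubgroup UpperHalfPlane
open Literature.NumberTheory.EllipticCurves Literature.NumberTheory.EllipticCurves.ModularForms

/-! ## Injectivity of `(M, g) ↦ (aₘ(g))ₘ` on newforms of level `N·M` -/

/-- Strong multiplicity one, in the form used here: if newforms `g ∈ S₂(Γ₀(N·M))`,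
`g' ∈ S₂(Γ₀(N·M'))` (`N ≠ 0`) have the same `q`-expansion then `(M, g) = (M', g')` as dependent
pairs. Indeed their Hecke eigenvalues agree at every prime (`T_ℓ g = a_ℓ(g) g`,
`IsNewform0.heckeEigenvalue_eq_coeff_holds`), so the levels agree
(`IsNewform0.level_eq_of_heckeEigenvalue_eq_holds`, Atkin–Lehner 1970 Thm. 4), hence `M = M'`, and
then `g = g'` by the `q`-expansion principle (`eq_of_forall_cuspCoeff_eq_gamma0`).
[cite: AtkinLehner1970, Thm. 4] -/
theorem stubF_sigma_mk_eq_of_qExpansion_coeff_eq {N M M' : ℕ} (hN : N ≠ 0) [NeZero (N * M)]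
    [NeZero (N * M')] {g : CuspForm (Gamma0 (N * M)) 2} {g' : CuspForm (Gamma0 (N * M')) 2}
    (hg : IsNewform0 g) (hg' : IsNewform0 g')
    (h : ∀ m : ℕ, (qExpansion 1 ⇑g).coeff m = (qExpansion 1 ⇑g').coeff m) :
    (⟨M, g⟩ : Σ M : ℕ, CuspForm (Gamma0 (N * M)) 2) = ⟨M', g'⟩ := by
  have hfin : {q : ℕ | q.Prime ∧ heckeEigenvalue g q ≠ heckeEigenvalue g' q}.Finite := by
    refine Set.finite_empty.subset ?_
    rintro q ⟨hq, hne⟩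
    exact hne (by rw [IsNewform0.heckeEigenvalue_eq_coeff_holds hg hq,
      IsNewform0.heckeEigenvalue_eq_coeff_holds hg' hq, h q])
  have hlev : N * M = N * M' := IsNewform0.level_eq_of_heckeEigenvalue_eq_holds hg hg' hfin
  obtain rfl : M = M' := Nat.eq_of_mul_eq_mul_left (Nat.pos_of_ne_zero hN) hlev
  obtain rfl : g = g' := eq_of_forall_cuspCoeff_eq_gamma0 fun m ↦ h m
  rfl

/-! ## The image: Eichler–Shimura curves deeply congruent to `W` -/

/-- From a newform `g ∈ S₂(Γ₀(N_W·M))` with integer `q`-expansion which is depth-`n` congruent to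
`W` — `φ(a_ℓ(g)) = a_ℓ(W)` in `ℤ/pⁿ` for the primes `ℓ ∤ N_W·M` — the Eichler–Shimura construction
(hypothesis `eichlerShimuraConstruction`; Knapp 1993 Thm. 11.74 with Carayol, Thm. 12.8) yields an
elliptic curve `E_g/ℚ` with `aₘ(g) = aₘ(E_g)` for all `m` and `pⁿ ∣ a_ℓ(E_g) − a_ℓ(W)` for every
prime `ℓ ∤ N_W·M` (`map_intCast`, `a_ℓ(W) = frobeniusTrace W ℓ` at the primes `ℓ ∤ N_W` of good
reduction, `WeierstrassCurve.LFunction_apply_prime_eq_frobeniusTrace` and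
`WeierstrassCurve.dvd_conductorNorm_iff_not_hasGoodReductionAtPrime`); in particular the set of
exceptional primes is finite. [cite: Knapp1993, Thm. 11.74 and Thm. 12.8] -/
theorem stubF_exists_curve_of_congruent (hES : eichlerShimuraConstruction)
    (W : WeierstrassCurve ℚ) [W.IsElliptic] [W.IsGloballyMinimal] (p n M : ℕ)
    [NeZero (W.conductorNorm ℤ * M)] {g : CuspForm (Gamma0 (W.conductorNorm ℤ * M)) 2}
    (hg : IsNewform0 g) (hint : ∀ m : ℕ, ∃ a : ℤ, (qExpansion 1 ⇑g).coeff m = (a : ℂ))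
    (R : Subring ℂ) (φ : R →+* ZMod (p ^ n))
    (hR : ∀ ℓ : ℕ, ℓ.Prime → ¬ ℓ ∣ W.conductorNorm ℤ * M → heckeEigenvalue g ℓ ∈ R)
    (hcong : ∀ (ℓ : ℕ) (hℓ : ℓ.Prime) (hℓL : ¬ ℓ ∣ W.conductorNorm ℤ * M),
      φ ⟨heckeEigenvalue g ℓ, hR ℓ hℓ hℓL⟩ = ((W.frobeniusTrace ℓ : ℤ) : ZMod (p ^ n))) :
    ∃ (W' : WeierstrassCurve ℚ) (_ : W'.IsElliptic),
      (∀ m : ℕ, (qExpansion 1 ⇑g).coeff m = ((W'.LFunction m : ℤ) : ℂ)) ∧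
      {ℓ : ℕ | ℓ.Prime ∧ ¬ ((p : ℤ) ^ n ∣ W'.LFunction ℓ - W.LFunction ℓ)}.Finite := by
  obtain ⟨W', hW'ell, hW', -⟩ := hES hg hint
  refine ⟨W', hW'ell, hW'.2, ?_⟩
  refine (Finset.finite_toSet (W.conductorNorm ℤ * M).divisors).subset ?_
  rintro ℓ ⟨hℓ, hndvd⟩
  rw [Finset.mem_coe, Nat.mem_divisors]
  refine ⟨by_contra fun hℓL ↦ hndvd ?_, NeZero.ne _⟩
  haveI := Fact.mk hℓ
  have hgood : W.HasGoodReductionAtPrime ℓ := by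
    by_contra hbad
    exact hℓL (dvd_mul_of_dvd_left
      ((W.dvd_conductorNorm_iff_not_hasGoodReductionAtPrime ℓ).mpr hbad) M)
  have hval : heckeEigenvalue g ℓ = ((W'.LFunction ℓ : ℤ) : ℂ) := by
    rw [IsNewform0.heckeEigenvalue_eq_coeff_holds hg hℓ]
    exact hW'.2 ℓ
  have hy : (⟨heckeEigenvalue g ℓ, hR ℓ hℓ hℓL⟩ : R) = ((W'.LFunction ℓ : ℤ) : R) :=
    Subtype.ext (show heckeEigenvalue g ℓ = (((W'.LFunction ℓ : ℤ) : R) : ℂ) by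
      rw [SubringClass.coe_intCast]; exact hval)
  have h := hcong ℓ hℓ hℓL
  rw [hy, map_intCast, ← W.LFunction_apply_prime_eq_frobeniusTrace ℓ hgood,
    ZMod.intCast_eq_intCast_iff_dvd_sub, Nat.cast_pow] at h
  exact dvd_sub_comm.mp h

/-! ## The stub -/

/-- Stub **F_rat** (Mordell–Faltings finiteness of deep RATIONAL congruences, GIVEN the
Eichler–Shimura construction and `DeepCongruenceFinite`). For `W/ℚ` globally minimal elliptic and
`p ≥ 5` good ordinary with `E[p]` irreducible there is a depth `n` (namely `n = 2`, `p² ≥ 7`) at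
which only finitely many pairs `(M, g)` — `M` squarefree coprime to `p·N_W`, `g` a newform of level
`N_W·M` with integer `q`-expansion — are depth-`n` congruent to `W`: the coefficient map
`(M, g) ↦ (aₘ(g))ₘ` is injective on such pairs (`stubF_sigma_mk_eq_of_qExpansion_coeff_eq`) and
takes values in the image of the finite set of `DeepCongruenceFinite` under `ℤ^ℕ → ℂ^ℕ`
(`stubF_exists_curve_of_congruent`). [cite: Faltings1983Endlichkeit, Satz 7]
[cite: Knapp1993, Thm. 11.74 and Thm. 12.8] -/
theorem stub_rationalSectorFinite : eichlerShimuraConstruction → DeepCongruenceFinite →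
    ∀ (W : WeierstrassCurve ℚ) [W.IsElliptic] [W.IsGloballyMinimal] (p : ℕ) [Fact p.Prime],
      5 ≤ p → W.HasGoodReductionAtPrime p → ¬ (p : ℤ) ∣ W.frobeniusTrace p →
      W.HasIrreducibleModPGaloisRep p →
      ∃ n : ℕ, Set.Finite {x : Σ M : ℕ, CuspForm (CongruenceSubgroup.Gamma0 (W.conductorNorm ℤ * M)) 2 |
        ∃ (_ : NeZero (W.conductorNorm ℤ * x.1)) (R : Subring ℂ) (φ : R →+* ZMod (p ^ n)) (hR : ∀ ℓ : ℕ, ℓ.Prime → ¬ ℓ ∣ W.conductorNorm ℤ * x.1 → heckeEigenvalue x.2 ℓ ∈ R), (∀ m : ℕ, ∃ a : ℤ, (qExpansion 1 ⇑(x.2)).coeff m = (a : ℂ)) ∧ Squarefree x.1 ∧ Nat.Coprime x.1 (p * W.conductorNorm ℤ) ∧ IsNewform0 x.2 ∧ (∀ (ℓ : ℕ) (hℓ : ℓ.Prime) (hℓL : ¬ ℓ ∣ W.conductorNorm ℤ * x.1), φ ⟨heckeEigenvalue x.2 ℓ, hR ℓ hℓ hℓL⟩ = ((W.frobeniusTrace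 ℓ : ℤ) : ZMod (p ^ n)))} := by
  intro hES hDC W _ _ p _ hp5 _ _ hirr
  refine ⟨2, ?_⟩
  have hN : W.conductorNorm ℤ ≠ 0 := (WeierstrassCurve.conductorNorm_pos_holds W).ne'
  have h7 : 7 ≤ p ^ 2 := le_trans (by norm_num) (Nat.pow_le_pow_left hp5 2)
  -- the finite set of `L`-coefficient systems of elliptic curves depth-`2` congruent to `W`
  have hF := hDC W p 2 (by omega) hirr h7
  refine Set.Finite.of_finite_image (f := fun x m ↦ (qExpansion 1 ⇑x.2).coeff m) ?_ ?_
  · -- the image is contained in the complexification of that finite set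
    refine (hF.image fun (a : ℕ → ℤ) (m : ℕ) ↦ (a m : ℂ)).subset ?_
    rintro _ ⟨⟨M, g⟩, ⟨inst, R, φ, hR, hint, -, -, hg, hcong⟩, rfl⟩
    obtain ⟨W', hW'ell, hcoeff, hfin⟩ :=
      stubF_exists_curve_of_congruent hES W p 2 M hg hint R φ hR hcong
    exact ⟨fun m ↦ W'.LFunction m, ⟨W', hW'ell, fun _ ↦ rfl, hfin⟩,
      funext fun m ↦ (hcoeff m).symm⟩
  · -- the coefficient map is injective on the set
    rintro ⟨M, g⟩ ⟨inst, -, -, -, -, -, -, hg, -⟩ ⟨M', g'⟩ ⟨inst', -, -, -, -, -, -, hg', -⟩ hqq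
    exact stubF_sigma_mk_eq_of_qExpansion_coeff_eq hN hg hg' fun m ↦ congr_fun hqq m

end Summit.BirchSwinnertonDyer.BirchSwinnertonDyer.Theorems

end
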